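import Summits.NavierStokesRegularity.NavierStokesRegularity.Theorems.TerminalTraceTypeITraceScarL3ApexPackageTranslate
import Summits.NavierStokesRegularity.NavierStokesRegularity.Theorems.TerminalTraceTypeITraceScarL3StubNoConfinedExtinctApex
import Literature.Analysis.FluidPDE.LocalTypeI
import HarnessLib

/-!
# LOUD-APEX HEREDITY: every top singular point of an extinct Type-I apex is again a SPREAD (and, under
# quiet-shell exclusion, LOUD) backward-singular apex of the same class
# (item `TerminalTrace.TypeITraceScarL3`, stmt-NavierStokesRegularity-18385; BRIEF-cdisprove-18385 §(iii)
# `loudApex_heredity`, ROUND-25 s25-5 / ROUND-26 §3a)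

Seat ns-typeII-p3 g10 (cell ns-regularity-ideate), `--supports stmt-NavierStokesRegularity-18385` (helper).
With the translation covariance of the package (`apexPackage_translate`, p590976) and the landed Stub B
(`stub_no_confinedExtinctApex`, p585263: a CONFINED extinct Type-I apex is not backward singular at the origin):

* `spread_translate_of_topSingular` — if `(U, P, G)` carries the package of class `(M, D₀, C)` and `(0, x)` is
  backward singular, then the translate `U(·, · + x)` is SPREAD (essentially unbounded in every exterior late
  region): otherwise it is a confined apex of the same class, regular at its origin by Stub B;
* `loudApex_heredity` — the full heredity statement of the BRIEF: package for the translate (same class) ∧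
  SPREAD for the translate ∧ backward singular at the origin;
* `not_quietShell_translate_of_topSingular` — under quiet-shell exclusion at ratio `A₀` for the class (the
  hypothesis `hQA` of `stub_no_loudShellExtinctApex`, verbatim) the translate has NO quiet shell of ratio `A₀`:
  every top singular point of a loud survivor is itself a LOUD apex (ROUND-26 §3a (S2), pointwise form).

WHAT THIS IS NOT: not Stub C / QA / LOUD, not NS regularity — heredity bookkeeping for the disprover and the
loud-dust prover. [folklore; AlbrittonBarker2019 §3; Seregin2014 §6.6]
-/

noncomputable section

set_option linter.dupNamespace false

namespace Summit.NavierStokesRegularity.NavierStokesRegularity.Theorems.TypeITraceScarL3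

open MeasureTheory Set Function Filter Topology Metric
open Literature.Analysis.FluidPDE
open scoped NNReal ENNReal InnerProductSpace RealInnerProductSpace

/-- **A top singular point makes the translate SPREAD.**  If `(U, P, G)` carries the extinct Type-I apex
package of class `(M, D₀, C)` and `(0, x)` is backward singular, then the translate `(s, y) ↦ U(s, y + x)` is
essentially unbounded in every exterior late region `]−δ, 0[ × (B̄(0,R))ᶜ` — else it would be a CONFINED apex
of the same class (`apexPackage_translate`), not backward singular at its origin by Stub B
(`stub_no_confinedExtinctApex`), contradicting `isBackwardSingularPoint_translate_zero_iff`.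
[folklore; Seregin2014 §6.6 (Thm 6.21)] -/
theorem spread_translate_of_topSingular
    {M D₀ : ℝ≥0} {C : ℝ}
    {U : ℝ → EuclideanSpace ℝ (Fin 3) → EuclideanSpace ℝ (Fin 3)}
    {P : ℝ → EuclideanSpace ℝ (Fin 3) → ℝ}
    {G : ℝ → EuclideanSpace ℝ (Fin 3) → EuclideanSpace ℝ (Fin 3) →L[ℝ] EuclideanSpace ℝ (Fin 3)}
    (hsw : ∀ a : ℝ, 0 < a →
      IsSuitableWeakSolutionInBall a (0 : ℝ × EuclideanSpace ℝ (Fin 3)) U P)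
    (hG : ∀ a : ℝ, 0 < a →
      HasWeakSpatialGradientOn
        (parabolicCylinderOpens a (0 : ℝ × EuclideanSpace ℝ (Fin 3))) U G)
    (hI : ∀ a : ℝ, 0 < a →
      typeIBound (parabolicCylinder a (0 : ℝ × EuclideanSpace ℝ (Fin 3))) U P G ≤ M)
    (hD : ∀ z₀ : ℝ × EuclideanSpace ℝ (Fin 3), z₀.1 ≤ 0 →
      ∀ r : ℝ, 0 < r → cknD r z₀ P ≤ D₀)
    (hrate : ∀ s : ℝ, s < 0 →
      ∀ᵐ y : EuclideanSpace ℝ (Fin 3), ‖U s y‖ ≤ C / Real.sqrt (-s))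
    (htop : ∀ φ : EuclideanSpace ℝ (Fin 3) → EuclideanSpace ℝ (Fin 3),
      ContDiff ℝ (⊤ : ℕ∞) φ →
      HasCompactSupport φ → ∀ ε : ℝ, 0 < ε →
      ∃ s₀ : ℝ, s₀ < 0 ∧ ∀ᵐ s ∂(volume.restrict (Ioo s₀ 0)), |∫ y, ⟪U s y, φ y⟫| ≤ ε)
    {x : EuclideanSpace ℝ (Fin 3)} (hx : IsBackwardSingularPoint U ((0 : ℝ), x)) :
    ∀ δ : ℝ, 0 < δ → ∀ R K : ℝ,
      ¬ (∀ᵐ z ∂(volume.restrict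
        (Ioo (-δ) 0 ×ˢ (closedBall (0 : EuclideanSpace ℝ (Fin 3)) R)ᶜ)),
          ‖(fun s y => U s (y + x)) z.1 z.2‖ ≤ K) := by
  intro δ hδ R K hconf
  obtain ⟨hsw', hG', hI', hD', hrate', htop'⟩ := apexPackage_translate x hsw hG hI hD hrate htop
  have hreg := stub_no_confinedExtinctApex _ _ _ M D₀ C hsw' hG' hI' hD' hrate' htop' ⟨δ, hδ, R, K, hconf⟩
  exact hreg ((isBackwardSingularPoint_translate_zero_iff x U).2 hx)

/-- **LOUD-APEX HEREDITY (`loudApex_heredity` of BRIEF-cdisprove-18385 §(iii)).**  If `(U, P, G)` carries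
the extinct Type-I apex package of class `(M, D₀, C)` and `(0, x)` is backward singular, then the translate
`(U, P, G)(·, · + x)` carries the SAME package, is SPREAD, and is backward singular at the origin — every top
singular point is again a spread backward-singular apex of the class. [folklore; AlbrittonBarker2019 §3] -/
theorem loudApex_heredity
    {M D₀ : ℝ≥0} {C : ℝ}
    {U : ℝ → EuclideanSpace ℝ (Fin 3) → EuclideanSpace ℝ (Fin 3)}
    {P : ℝ → EuclideanSpace ℝ (Fin 3) → ℝ}
    {G : ℝ → EuclideanSpace ℝ (Fin 3) → EuclideanSpace ℝ (Fin 3) →L[ℝ] EuclideanSpace ℝ (Fin 3)}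
    (hsw : ∀ a : ℝ, 0 < a →
      IsSuitableWeakSolutionInBall a (0 : ℝ × EuclideanSpace ℝ (Fin 3)) U P)
    (hG : ∀ a : ℝ, 0 < a →
      HasWeakSpatialGradientOn
        (parabolicCylinderOpens a (0 : ℝ × EuclideanSpace ℝ (Fin 3))) U G)
    (hI : ∀ a : ℝ, 0 < a →
      typeIBound (parabolicCylinder a (0 : ℝ × EuclideanSpace ℝ (Fin 3))) U P G ≤ M)
    (hD : ∀ z₀ : ℝ × EuclideanSpace ℝ (Fin 3), z₀.1 ≤ 0 →
      ∀ r : ℝ, 0 < r → cknD r z₀ P ≤ D₀)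
    (hrate : ∀ s : ℝ, s < 0 →
      ∀ᵐ y : EuclideanSpace ℝ (Fin 3), ‖U s y‖ ≤ C / Real.sqrt (-s))
    (htop : ∀ φ : EuclideanSpace ℝ (Fin 3) → EuclideanSpace ℝ (Fin 3),
      ContDiff ℝ (⊤ : ℕ∞) φ →
      HasCompactSupport φ → ∀ ε : ℝ, 0 < ε →
      ∃ s₀ : ℝ, s₀ < 0 ∧ ∀ᵐ s ∂(volume.restrict (Ioo s₀ 0)), |∫ y, ⟪U s y, φ y⟫| ≤ ε)
    {x : EuclideanSpace ℝ (Fin 3)} (hx : IsBackwardSingularPoint U ((0 : ℝ), x)) :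
    ((∀ a : ℝ, 0 < a →
      IsSuitableWeakSolutionInBall a (0 : ℝ × EuclideanSpace ℝ (Fin 3))
        (fun s y => U s (y + x)) (fun s y => P s (y + x))) ∧
    (∀ a : ℝ, 0 < a →
      HasWeakSpatialGradientOn
        (parabolicCylinderOpens a (0 : ℝ × EuclideanSpace ℝ (Fin 3)))
        (fun s y => U s (y + x)) (fun s y => G s (y + x))) ∧
    (∀ a : ℝ, 0 < a →
      typeIBound (parabolicCylinder a (0 : ℝ × EuclideanSpace ℝ (Fin 3)))
        (fun s y => U s (y + x)) (fun s y => P s (y + x)) (fun s y => G s (y + x)) ≤ M) ∧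
    (∀ z₀ : ℝ × EuclideanSpace ℝ (Fin 3), z₀.1 ≤ 0 →
      ∀ r : ℝ, 0 < r → cknD r z₀ (fun s y => P s (y + x)) ≤ D₀) ∧
    (∀ s : ℝ, s < 0 →
      ∀ᵐ y : EuclideanSpace ℝ (Fin 3), ‖(fun s y => U s (y + x)) s y‖ ≤ C / Real.sqrt (-s)) ∧
    (∀ φ : EuclideanSpace ℝ (Fin 3) → EuclideanSpace ℝ (Fin 3),
      ContDiff ℝ (⊤ : ℕ∞) φ →
      HasCompactSupport φ → ∀ ε : ℝ, 0 < ε →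
      ∃ s₀ : ℝ, s₀ < 0 ∧ ∀ᵐ s ∂(volume.restrict (Ioo s₀ 0)),
        |∫ y, ⟪(fun s y => U s (y + x)) s y, φ y⟫| ≤ ε)) ∧
    (∀ δ : ℝ, 0 < δ → ∀ R K : ℝ,
      ¬ (∀ᵐ z ∂(volume.restrict
        (Ioo (-δ) 0 ×ˢ (closedBall (0 : EuclideanSpace ℝ (Fin 3)) R)ᶜ)),
          ‖(fun s y => U s (y + x)) z.1 z.2‖ ≤ K)) ∧
    IsBackwardSingularPoint (fun s y => U s (y + x)) (0 : ℝ × EuclideanSpace ℝ (Fin 3)) :=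
  ⟨apexPackage_translate x hsw hG hI hD hrate htop,
    spread_translate_of_topSingular hsw hG hI hD hrate htop hx,
    (isBackwardSingularPoint_translate_zero_iff x U).2 hx⟩

/-- **Under quiet-shell exclusion every top singular point is a LOUD apex** (ROUND-26 §3a (S2), pointwise):
if `A₀` is a quiet-shell-excluding ratio for the class (the hypothesis `hQA` of `stub_no_loudShellExtinctApex`,
verbatim), `(U, P, G)` carries the package and `(0, x)` is backward singular, then the translate `U(·, · + x)`
has NO quiet shell of ratio `A₀`. [folklore] -/
theorem not_quietShell_translate_of_topSingular
    {M D₀ : ℝ≥0} {C A₀ : ℝ}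
    (hQA : ∀ (U : ℝ → EuclideanSpace ℝ (Fin 3) → EuclideanSpace ℝ (Fin 3))
      (P : ℝ → EuclideanSpace ℝ (Fin 3) → ℝ)
      (G : ℝ → EuclideanSpace ℝ (Fin 3) →
        EuclideanSpace ℝ (Fin 3) →L[ℝ] EuclideanSpace ℝ (Fin 3)),
      (∀ a : ℝ, 0 < a →
        IsSuitableWeakSolutionInBall a (0 : ℝ × EuclideanSpace ℝ (Fin 3)) U P) →
      (∀ a : ℝ, 0 < a →
        HasWeakSpatialGradientOn
          (parabolicCylinderOpens a (0 : ℝ × EuclideanSpace ℝ (Fin 3))) U G) →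
      (∀ a : ℝ, 0 < a →
        typeIBound (parabolicCylinder a (0 : ℝ × EuclideanSpace ℝ (Fin 3))) U P G ≤ M) →
      (∀ z₀ : ℝ × EuclideanSpace ℝ (Fin 3), z₀.1 ≤ 0 →
        ∀ r : ℝ, 0 < r → cknD r z₀ P ≤ D₀) →
      (∀ s : ℝ, s < 0 →
        ∀ᵐ y : EuclideanSpace ℝ (Fin 3), ‖U s y‖ ≤ C / Real.sqrt (-s)) →
      (∀ φ : EuclideanSpace ℝ (Fin 3) → EuclideanSpace ℝ (Fin 3),
        ContDiff ℝ (⊤ : ℕ∞) φ →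
        HasCompactSupport φ → ∀ ε : ℝ, 0 < ε →
        ∃ s₀ : ℝ, s₀ < 0 ∧ ∀ᵐ s ∂(volume.restrict (Ioo s₀ 0)), |∫ y, ⟪U s y, φ y⟫| ≤ ε) →
      (∃ δ : ℝ, 0 < δ ∧ ∃ R : ℝ, 0 < R ∧ ∃ K : ℝ,
        ∀ᵐ z ∂(volume.restrict
          (Ioo (-δ) 0 ×ˢ {y : EuclideanSpace ℝ (Fin 3) | R < ‖y‖ ∧ ‖y‖ < A₀ * R})),
            ‖U z.1 z.2‖ ≤ K) →
      ¬ IsBackwardSingularPoint U (0 : ℝ × EuclideanSpace ℝ (Fin 3)))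
    {U : ℝ → EuclideanSpace ℝ (Fin 3) → EuclideanSpace ℝ (Fin 3)}
    {P : ℝ → EuclideanSpace ℝ (Fin 3) → ℝ}
    {G : ℝ → EuclideanSpace ℝ (Fin 3) → EuclideanSpace ℝ (Fin 3) →L[ℝ] EuclideanSpace ℝ (Fin 3)}
    (hsw : ∀ a : ℝ, 0 < a →
      IsSuitableWeakSolutionInBall a (0 : ℝ × EuclideanSpace ℝ (Fin 3)) U P)
    (hG : ∀ a : ℝ, 0 < a →
      HasWeakSpatialGradientOn
        (parabolicCylinderOpens a (0 : ℝ × EuclideanSpace ℝ (Fin 3))) U G)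
    (hI : ∀ a : ℝ, 0 < a →
      typeIBound (parabolicCylinder a (0 : ℝ × EuclideanSpace ℝ (Fin 3))) U P G ≤ M)
    (hD : ∀ z₀ : ℝ × EuclideanSpace ℝ (Fin 3), z₀.1 ≤ 0 →
      ∀ r : ℝ, 0 < r → cknD r z₀ P ≤ D₀)
    (hrate : ∀ s : ℝ, s < 0 →
      ∀ᵐ y : EuclideanSpace ℝ (Fin 3), ‖U s y‖ ≤ C / Real.sqrt (-s))
    (htop : ∀ φ : EuclideanSpace ℝ (Fin 3) → EuclideanSpace ℝ (Fin 3),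
      ContDiff ℝ (⊤ : ℕ∞) φ →
      HasCompactSupport φ → ∀ ε : ℝ, 0 < ε →
      ∃ s₀ : ℝ, s₀ < 0 ∧ ∀ᵐ s ∂(volume.restrict (Ioo s₀ 0)), |∫ y, ⟪U s y, φ y⟫| ≤ ε)
    {x : EuclideanSpace ℝ (Fin 3)} (hx : IsBackwardSingularPoint U ((0 : ℝ), x)) :
    ¬ ∃ δ : ℝ, 0 < δ ∧ ∃ R : ℝ, 0 < R ∧ ∃ K : ℝ,
      ∀ᵐ z ∂(volume.restrict
        (Ioo (-δ) 0 ×ˢ {y : EuclideanSpace ℝ (Fin 3) | R < ‖y‖ ∧ ‖y‖ < A₀ * R})),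
          ‖(fun s y => U s (y + x)) z.1 z.2‖ ≤ K := by
  intro hquiet
  obtain ⟨hsw', hG', hI', hD', hrate', htop'⟩ := apexPackage_translate x hsw hG hI hD hrate htop
  exact hQA _ _ _ hsw' hG' hI' hD' hrate' htop' hquiet ((isBackwardSingularPoint_translate_zero_iff x U).2 hx)

end Summit.NavierStokesRegularity.NavierStokesRegularity.Theorems.TypeITraceScarL3

end
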